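import Summits.Ventures.HSemireg.WedgeHankelRecurrenceModule
import Summits.Ventures.HSemireg.WedgeHankelKernelColumnSpaceIff

/-!
# Venture HSemireg — RECURRENCES vs KERNELS: the recurrence space `Rec_k(q)` (the left kernel of the catalecticant) is the ANNIHILATOR of the column space `col H_k(q) ⊆ K^{k+1}`,
# so **`Rec_k(q′) ⊆ Rec_k(q) ↔ col H_k(q) ⊆ col H_k(q′)`** (families: common recurrences vs the sum of the column spaces) and, with M14/N5, **`Kr(univ, w_N(q), k) ⊆ Kr(univ, w_N(q′), k)
# ↔ Rec_k(q) ⊆ Rec_k(q′)`** (`k ≤ N`): a class has more degree-`k` annihilators iff its coefficients satisfy more linear recurrences of window `k + 1`; the recurrences of one window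
# determine those of every shorter window (the polynomial shadow of N8/N10)

HONEST FRAMING. Part of the Lean index of the computation cell `pub-hsemireg` (seat p10 gen 26, Sunday typer «UNIFORM-IN-n»).
LINEAR ALGEBRA OF HANKEL (catalecticant) MATRICES and of polynomials over a field + (through the cited tree theorems) finite-dimensional EXTERIOR ALGEBRA ONLY: no variety, no cohomology
theory, no sheaf, no Ext group and no semiregularity map is constructed here; nothing here says that HC / HC_CM / HC_AV holds; no Literature fact is declared or used.  Custodian versions
as in `WedgeHankelSiegelIdeal` (1/3); the dictionary (`Kr(univ, w_N(q), k)` = the degree-`k` kernel of `θ ↦ θ ∧ w_N(q)`; `Rec_k(q)` = the recurrences of window `k + 1`) is QUOTED, never asserted.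

WHAT IS IN THE TREE / KEYED.  N18 (`WedgeHankelRecurrenceModule`, № 173): `recSpace`, `mem_recSpace_iff_vecMul_eq_zero`, `recSpace_le_degreeLT`, `recSpace_mono`, `X_pow_mul_mem_recSpace_add`,
`hkFun_X_pow_mul`; N5 (`WedgeHankelKernelColumnSpaceIff`, tree) `Kr_w_le_Kr_w_iff_range_le`, `Hom_iInf_Kr_w_le_iff_iSup_range_le`, `Hom_iInf_Kr_w_le_Kr_w_iff_range_le_iSup`,
`V_w_le_V_w_iff_range_le`, `V_w_eq_V_w_iff_range_eq` (the kernel / mirror image is a function of `col H_k(q)`).  Mathlib: `Submodule.exists_dual_map_eq_bot_of_notMem` (a vector outside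
a subspace is detected by a functional killing the subspace), `LinearMap.pi_apply_eq_sum_univ`, `Matrix.dotProduct_mulVec`, `dotProduct_single_one`, `Polynomial.degreeLTEquiv`.
THIS FILE (namespace `Summit.Ventures.HSemireg.Wedge.HankelOuter` continued; CHAINED on N18; 0 definitions):
* §475 `vecMul_eq_zero_iff_forall_dotProduct` (`a ᵥ* M = 0 ↔ a ⊥ col M`), `forall_vecMul_eq_zero_iff_forall_dotProduct` (families: `⊥ Σ_c col M_c`), `moduleDual_pi_apply_eq_dotProduct`.
* §476 `vecMul_hankel1_eq_zero_iff_symm_mem_recSpace` (coefficient vectors ↔ polynomials); **`inf_iInf_recSpace_le_iff_iSup_range_le`** (families `q`, `q′`: `K[X]_{≤k} ⊓ ⋂_c Rec_k(q′_c) ⊆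
  K[X]_{≤k} ⊓ ⋂_c Rec_k(q_c) ↔ Σ_c col H_k(q_c) ⊆ Σ_c col H_k(q′_c)`), `inf_iInf_recSpace_eq_iff_iSup_range_eq`, **`inf_iInf_recSpace_le_recSpace_iff_range_le_iSup`** (one class against a family),
  **`recSpace_le_recSpace_iff_range_le`** (`Rec_k(q′) ⊆ Rec_k(q) ↔ col H_k(q) ⊆ col H_k(q′)`), `recSpace_eq_recSpace_iff_range_eq`.
* §477 with N5 (`k ≤ N`): **`Kr_w_le_Kr_w_iff_recSpace_le`** (`Kr(univ, w_N q, k) ⊆ Kr(univ, w_N q′, k) ↔ Rec_k(q) ⊆ Rec_k(q′)`), **`Kr_w_eq_Kr_w_iff_recSpace_eq`**, families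
  **`Hom_iInf_Kr_w_le_iff_inf_iInf_recSpace_le`** (joint kernels compare as common recurrences do), **`Hom_iInf_Kr_w_le_Kr_w_iff_inf_iInf_recSpace_le`** (a class is killed by the joint kernel of a
  family iff its coefficients satisfy every common recurrence of the family), images `V_w_le_V_w_iff_recSpace_le` / `V_w_eq_V_w_iff_recSpace_eq` (`k + k′ = N`, antitone).
* §478 **`recSpace_mono_of_le_degree`** (`k′ ≤ k ≤ N`: `Rec_k(q′) ⊆ Rec_k(q) ⇒ Rec_{k′}(q′) ⊆ Rec_{k′}(q)` — by shifting `p ↦ X^t p` inside the window; the column-side form is N10's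
  `range_hankel1_mono_of_le`, not restated), `recSpace_eq_of_eq_degree`.
READING: M14/N5 said the kernel of a class is an antitone function of `col H_k(q)`; this file identifies the missing third vertex — `col H_k(q)` and `Rec_k(q)` are each other's
annihilators — so KERNELS and RECURRENCES are the SAME order: `Kr ↦ Rec` is monotone and injective degreewise, N18's census of `Rec` is N16's census of `Kr`, and N19/N20 (Prony)
name the kernels of the divisor classes by their divisor polynomials.  Nothing Ext-side.  New names only.
-/

open Module Polynomial
open scoped Matrix Polynomial

namespace Summit.Ventures.HSemireg.Wedge.HankelOuter

open Summit.Ventures.HSemireg.Wedge Summit.Ventures.HSemireg.Wedge.Kunneth Summit.Ventures.HSemireg.Wedge.Hankel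
  Summit.Ventures.HSemireg.Wedge.BasisFree Summit.Ventures.HSemireg.Wedge.HankelSiegel Summit.Ventures.HSemireg.Wedge.HankelSiegelIdeal
  Summit.Ventures.HSemireg.Wedge.KunnethKernel Summit.Ventures.HSemireg.Wedge.HankelFrameChange Summit.Ventures.HSemireg.Wedge.KernelDuality

variable (K : Type*) [Field K] {N : ℕ} {ι ι' : Type}

/-! ## §475. A left-kernel vector is a vector orthogonal to the column space -/

/-- `a ᵥ* M = 0` iff `a ⬝ x = 0` for every `x` in the column space of `M`. -/
theorem vecMul_eq_zero_iff_forall_dotProduct {m n : Type*} [Fintype m] [Fintype n] [DecidableEq n] (a : m → K) (M : Matrix m n K) :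
    a ᵥ* M = 0 ↔ ∀ x ∈ LinearMap.range M.mulVecLin, a ⬝ᵥ x = 0 := by
  constructor
  · rintro h _ ⟨v, rfl⟩
    rw [Matrix.mulVecLin_apply, Matrix.dotProduct_mulVec, h, zero_dotProduct]
  · intro h
    funext j
    rw [Pi.zero_apply, ← dotProduct_single_one (a ᵥ* M) j, ← Matrix.dotProduct_mulVec]
    exact h _ ⟨_, rfl⟩

/-- the family version: `a ᵥ* M_c = 0` for all `c` iff `a` is orthogonal to `Σ_c col M_c`. -/
theorem forall_vecMul_eq_zero_iff_forall_dotProduct {m n : Type*} [Fintype m] [Fintype n] [DecidableEq n] (a : m → K) (M : ι → Matrix m n K) :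
    (∀ c, a ᵥ* M c = 0) ↔ ∀ x ∈ ⨆ c, LinearMap.range (M c).mulVecLin, a ⬝ᵥ x = 0 := by
  let φ : (m → K) →ₗ[K] K :=
    { toFun := fun x => a ⬝ᵥ x
      map_add' := fun x y => dotProduct_add a x y
      map_smul' := fun c x => by rw [dotProduct_smul, RingHom.id_apply] }
  have key : ∀ U : Submodule K (m → K), (∀ x ∈ U, a ⬝ᵥ x = 0) ↔ U ≤ LinearMap.ker φ := fun U => Iff.rfl
  rw [key, iSup_le_iff]
  exact forall_congr' fun c => by rw [← key, vecMul_eq_zero_iff_forall_dotProduct]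

/-- a linear functional on `K^m` is a dot product. -/
theorem moduleDual_pi_apply_eq_dotProduct {m : Type*} [Fintype m] [DecidableEq m] (f : Module.Dual K (m → K)) (x : m → K) :
    f x = (fun i => f (fun j => if i = j then 1 else 0)) ⬝ᵥ x := by
  rw [LinearMap.pi_apply_eq_sum_univ f x, dotProduct]
  exact Finset.sum_congr rfl fun i _ => by rw [smul_eq_mul, mul_comm]

/-! ## §476. The common recurrences of a family and the sum of its column spaces determine each other -/

/-- coefficient vectors vs polynomials: `a ᵥ* H_k(q) = 0 ↔ poly(a) ∈ Rec_k(q)`. -/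
theorem vecMul_hankel1_eq_zero_iff_symm_mem_recSpace (k : ℕ) (q : ℕ → K) (a : Fin (k + 1) → K) :
    a ᵥ* hankel1 K N k q = 0 ↔ ((Polynomial.degreeLTEquiv K (k + 1)).symm a : K[X]) ∈ recSpace K N q k := by
  rw [mem_recSpace_iff_vecMul_eq_zero, LinearEquiv.apply_symm_apply]

/-- **THE COMMON RECURRENCES vs THE SUM OF THE COLUMN SPACES: for two families `q`, `q′` and every degree `k`,
`K[X]_{≤k} ⊓ ⋂_c Rec_k(q′_c) ⊆ K[X]_{≤k} ⊓ ⋂_c Rec_k(q_c)` iff `Σ_c col H_k(q_c) ⊆ Σ_c col H_k(q′_c)`** (the left kernel is the annihilator of the column space, and a finite-dimensional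
subspace is cut out by the functionals vanishing on it). -/
theorem inf_iInf_recSpace_le_iff_iSup_range_le (k : ℕ) (q : ι → ℕ → K) (q' : ι' → ℕ → K) :
    Polynomial.degreeLT K (k + 1) ⊓ (⨅ c, recSpace K N (q' c) k) ≤ Polynomial.degreeLT K (k + 1) ⊓ (⨅ c, recSpace K N (q c) k)
      ↔ (⨆ c, LinearMap.range (hankel1 K N k (q c)).mulVecLin) ≤ ⨆ c, LinearMap.range (hankel1 K N k (q' c)).mulVecLin := by
  constructor
  · intro h x hx
    by_contra hx'
    obtain ⟨f, hfx, hfU⟩ := Submodule.exists_dual_map_eq_bot_of_notMem hx' inferInstance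
    set a : Fin (k + 1) → K := fun i => f (fun j => if i = j then 1 else 0) with ha
    have hf : ∀ y, f y = a ⬝ᵥ y := moduleDual_pi_apply_eq_dotProduct K f
    have hU : ∀ y ∈ ⨆ c, LinearMap.range (hankel1 K N k (q' c)).mulVecLin, a ⬝ᵥ y = 0 := by
      intro y hy
      rw [← hf]
      have : f y ∈ (⨆ c, LinearMap.range (hankel1 K N k (q' c)).mulVecLin).map f := Submodule.mem_map_of_mem hy
      rwa [hfU, Submodule.mem_bot] at this
    have hmem : ((Polynomial.degreeLTEquiv K (k + 1)).symm a : K[X]) ∈ Polynomial.degreeLT K (k + 1) ⊓ (⨅ c, recSpace K N (q' c) k) := by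
      refine Submodule.mem_inf.mpr ⟨((Polynomial.degreeLTEquiv K (k + 1)).symm a).2, (Submodule.mem_iInf _).mpr fun c => ?_⟩
      rw [← vecMul_hankel1_eq_zero_iff_symm_mem_recSpace]
      exact ((forall_vecMul_eq_zero_iff_forall_dotProduct K a fun c => hankel1 K N k (q' c)).mpr hU) c
    have hmem' := (Submodule.mem_iInf _).mp (Submodule.mem_inf.mp (h hmem)).2
    have hq : ∀ c, a ᵥ* hankel1 K N k (q c) = 0 := fun c => (vecMul_hankel1_eq_zero_iff_symm_mem_recSpace K k (q c) a).mpr (hmem' c)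
    exact hfx (by rw [hf]; exact (forall_vecMul_eq_zero_iff_forall_dotProduct K a fun c => hankel1 K N k (q c)).mp hq x hx)
  · intro h p hp
    obtain ⟨hdeg, hp'⟩ := Submodule.mem_inf.mp hp
    refine Submodule.mem_inf.mpr ⟨hdeg, (Submodule.mem_iInf _).mpr fun c => ?_⟩
    have ha : ∀ c', (Polynomial.degreeLTEquiv K (k + 1) ⟨p, hdeg⟩) ᵥ* hankel1 K N k (q' c') = 0 :=
      fun c' => (mem_recSpace_iff_vecMul_eq_zero K (q' c') ⟨p, hdeg⟩).mp ((Submodule.mem_iInf _).mp hp' c')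
    have hU := (forall_vecMul_eq_zero_iff_forall_dotProduct K _ fun c' => hankel1 K N k (q' c')).mp ha
    exact (mem_recSpace_iff_vecMul_eq_zero K (q c) ⟨p, hdeg⟩).mpr
      (((forall_vecMul_eq_zero_iff_forall_dotProduct K _ fun c => hankel1 K N k (q c)).mpr fun y hy => hU y (h hy)) c)

/-- equality form. -/
theorem inf_iInf_recSpace_eq_iff_iSup_range_eq (k : ℕ) (q : ι → ℕ → K) (q' : ι' → ℕ → K) :
    Polynomial.degreeLT K (k + 1) ⊓ (⨅ c, recSpace K N (q c) k) = Polynomial.degreeLT K (k + 1) ⊓ (⨅ c, recSpace K N (q' c) k)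
      ↔ (⨆ c, LinearMap.range (hankel1 K N k (q c)).mulVecLin) = ⨆ c, LinearMap.range (hankel1 K N k (q' c)).mulVecLin := by
  rw [le_antisymm_iff, le_antisymm_iff, inf_iInf_recSpace_le_iff_iSup_range_le K k q' q, inf_iInf_recSpace_le_iff_iSup_range_le K k q q', and_comm]

/-- one class against a family: **`q₀` satisfies every common recurrence of the `q_c` iff `col H_k(q₀) ⊆ Σ_c col H_k(q_c)`.** -/
theorem inf_iInf_recSpace_le_recSpace_iff_range_le_iSup (k : ℕ) (q : ι → ℕ → K) (q₀ : ℕ → K) :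
    Polynomial.degreeLT K (k + 1) ⊓ (⨅ c, recSpace K N (q c) k) ≤ recSpace K N q₀ k
      ↔ LinearMap.range (hankel1 K N k q₀).mulVecLin ≤ ⨆ c, LinearMap.range (hankel1 K N k (q c)).mulVecLin := by
  have h := inf_iInf_recSpace_le_iff_iSup_range_le K (N := N) k (fun _ : Unit => q₀) q
  rw [iSup_const, iInf_const, inf_eq_right.mpr (recSpace_le_degreeLT K q₀ k)] at h
  exact h

/-- two classes: **`Rec_k(q′) ⊆ Rec_k(q) ↔ col H_k(q) ⊆ col H_k(q′)`** — the recurrence space and the column space are ANTITONE images of each other. -/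
theorem recSpace_le_recSpace_iff_range_le (k : ℕ) (q q' : ℕ → K) :
    recSpace K N q' k ≤ recSpace K N q k ↔ LinearMap.range (hankel1 K N k q).mulVecLin ≤ LinearMap.range (hankel1 K N k q').mulVecLin := by
  have h := inf_iInf_recSpace_le_iff_iSup_range_le K (N := N) k (fun _ : Unit => q) (fun _ : Unit => q')
  rw [iSup_const, iSup_const, iInf_const, iInf_const, inf_eq_right.mpr (recSpace_le_degreeLT K q k), inf_eq_right.mpr (recSpace_le_degreeLT K q' k)] at h
  exact h

/-- `Rec_k(q) = Rec_k(q′) ↔ col H_k(q) = col H_k(q′)`. -/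
theorem recSpace_eq_recSpace_iff_range_eq (k : ℕ) (q q' : ℕ → K) :
    recSpace K N q k = recSpace K N q' k ↔ LinearMap.range (hankel1 K N k q).mulVecLin = LinearMap.range (hankel1 K N k q').mulVecLin := by
  rw [le_antisymm_iff, le_antisymm_iff, recSpace_le_recSpace_iff_range_le K k q' q, recSpace_le_recSpace_iff_range_le K k q q', and_comm]

/-! ## §477. Hence the recurrences and the kernel of the class determine each other (N5), monotonically -/

/-- **THE KERNEL AND THE RECURRENCES ARE MONOTONE IN EACH OTHER: for `k ≤ N`, `Kr(univ, w_N(q), k) ⊆ Kr(univ, w_N(q′), k) ↔ Rec_k(q) ⊆ Rec_k(q′)`** — a class has more degree-`k`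
annihilators iff its coefficients satisfy more recurrences of window `k + 1`. -/
theorem Kr_w_le_Kr_w_iff_recSpace_le {k : ℕ} (hk : k ≤ N) (q q' : ℕ → K) :
    Kr K (Finset.univ : Finset (In N)) (w K N N q) k ≤ Kr K (Finset.univ : Finset (In N)) (w K N N q') k ↔ recSpace K N q k ≤ recSpace K N q' k := by
  rw [Kr_w_le_Kr_w_iff_range_le K hk q' q, ← recSpace_le_recSpace_iff_range_le]

/-- **`Kr(univ, w_N(q), k) = Kr(univ, w_N(q′), k) ↔ Rec_k(q) = Rec_k(q′)`** (`k ≤ N`). -/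
theorem Kr_w_eq_Kr_w_iff_recSpace_eq {k : ℕ} (hk : k ≤ N) (q q' : ℕ → K) :
    Kr K (Finset.univ : Finset (In N)) (w K N N q) k = Kr K (Finset.univ : Finset (In N)) (w K N N q') k ↔ recSpace K N q k = recSpace K N q' k := by
  rw [le_antisymm_iff, le_antisymm_iff, Kr_w_le_Kr_w_iff_recSpace_le K hk, Kr_w_le_Kr_w_iff_recSpace_le K hk]

/-- families: **the joint kernels compare as the common recurrences do** (`k ≤ N`). -/
theorem Hom_iInf_Kr_w_le_iff_inf_iInf_recSpace_le [Fintype ι] [DecidableEq ι] [Fintype ι'] [DecidableEq ι'] {k : ℕ} (hk : k ≤ N)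
    (q : ι → ℕ → K) (q' : ι' → ℕ → K) :
    Hom K (In N) (Finset.univ : Finset (In N)) k ⊓ (⨅ c, Kr K (Finset.univ : Finset (In N)) (w K N N (q' c)) k)
        ≤ Hom K (In N) (Finset.univ : Finset (In N)) k ⊓ (⨅ c, Kr K (Finset.univ : Finset (In N)) (w K N N (q c)) k)
      ↔ Polynomial.degreeLT K (k + 1) ⊓ (⨅ c, recSpace K N (q' c) k) ≤ Polynomial.degreeLT K (k + 1) ⊓ (⨅ c, recSpace K N (q c) k) := by
  rw [Hom_iInf_Kr_w_le_iff_iSup_range_le K hk q q', inf_iInf_recSpace_le_iff_iSup_range_le]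

/-- **a class is killed by the joint kernel of a family iff its coefficients satisfy every common recurrence of the family** (`k ≤ N`). -/
theorem Hom_iInf_Kr_w_le_Kr_w_iff_inf_iInf_recSpace_le [Fintype ι] [DecidableEq ι] {k : ℕ} (hk : k ≤ N) (q : ι → ℕ → K) (q₀ : ℕ → K) :
    Hom K (In N) (Finset.univ : Finset (In N)) k ⊓ (⨅ c, Kr K (Finset.univ : Finset (In N)) (w K N N (q c)) k) ≤ Kr K (Finset.univ : Finset (In N)) (w K N N q₀) k
      ↔ Polynomial.degreeLT K (k + 1) ⊓ (⨅ c, recSpace K N (q c) k) ≤ recSpace K N q₀ k := by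
  rw [Hom_iInf_Kr_w_le_Kr_w_iff_range_le_iSup K hk q q₀, inf_iInf_recSpace_le_recSpace_iff_range_le_iSup]

/-- images, mirror degree: **`V(univ, w_N(q), k′) ⊆ V(univ, w_N(q′), k′) ↔ Rec_k(q′) ⊆ Rec_k(q)`** (`k + k′ = N`; antitone). -/
theorem V_w_le_V_w_iff_recSpace_le {k k' : ℕ} (hkk' : k + k' = N) (q q' : ℕ → K) :
    V K (In N) Finset.univ (w K N N q) k' ≤ V K (In N) Finset.univ (w K N N q') k' ↔ recSpace K N q' k ≤ recSpace K N q k := by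
  rw [V_w_le_V_w_iff_range_le K hkk' q q', recSpace_le_recSpace_iff_range_le]

/-- `V(univ, w_N(q), k′) = V(univ, w_N(q′), k′) ↔ Rec_k(q) = Rec_k(q′)` (`k + k′ = N`). -/
theorem V_w_eq_V_w_iff_recSpace_eq {k k' : ℕ} (hkk' : k + k' = N) (q q' : ℕ → K) :
    V K (In N) Finset.univ (w K N N q) k' = V K (In N) Finset.univ (w K N N q') k' ↔ recSpace K N q k = recSpace K N q' k := by
  rw [V_w_eq_V_w_iff_range_eq K hkk' q q', recSpace_eq_recSpace_iff_range_eq]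

/-! ## §478. The recurrences in one window determine the recurrences in all shorter windows (the polynomial shadow of N8) -/

/-- **`Rec_k(q′) ⊆ Rec_k(q) ⇒ Rec_{k′}(q′) ⊆ Rec_{k′}(q)` for `k′ ≤ k ≤ N`**: if `p ∈ Rec_{k′}(q′)` then the shifts `X^t p` (`t ≤ k − k′`) lie in `Rec_k(q′) ⊆ Rec_k(q)`, and their
Hankel functionals against `q` exhaust the window of `p`. -/
theorem recSpace_mono_of_le_degree {k k' : ℕ} (hk'k : k' ≤ k) (hkN : k ≤ N) {q q' : ℕ → K} (h : recSpace K N q' k ≤ recSpace K N q k) :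
    recSpace K N q' k' ≤ recSpace K N q k' := by
  intro p hp
  have hshift : ∀ t, t + k' ≤ k → Polynomial.X ^ t * p ∈ recSpace K N q k :=
    fun t ht => h (recSpace_mono K q' (by omega) (X_pow_mul_mem_recSpace_add K t hp))
  rw [mem_recSpace_iff] at hp ⊢
  refine ⟨hp.1, fun u hu => ?_⟩
  rcases le_or_gt u (N - k) with hle | hgt
  · have := ((mem_recSpace_iff K).mp (hshift 0 (by omega))).2 u (by omega)
    rwa [pow_zero, one_mul] at this
  · -- `u = s + t` with `s = N − k` and `t = u − (N − k) ≤ k − k′`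
    have := ((mem_recSpace_iff K).mp (hshift (u - (N - k)) (by omega))).2 (N - k) (by omega)
    rwa [hkFun_X_pow_mul, show N - k + (u - (N - k)) = u by omega] at this

/-- `Rec_k(q) = Rec_k(q′) ⇒ Rec_{k′}(q) = Rec_{k′}(q′)` for `k′ ≤ k ≤ N`. -/
theorem recSpace_eq_of_eq_degree {k k' : ℕ} (hk'k : k' ≤ k) (hkN : k ≤ N) {q q' : ℕ → K} (h : recSpace K N q k = recSpace K N q' k) :
    recSpace K N q k' = recSpace K N q' k' :=
  le_antisymm (recSpace_mono_of_le_degree K hk'k hkN h.le) (recSpace_mono_of_le_degree K hk'k hkN h.ge)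

end Summit.Ventures.HSemireg.Wedge.HankelOuter
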